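/-
Copyright (c) 2026 the pub-hodgecm-mathlib formalisation cell (harness21).  Prover seat hodgecm-mathlib-LH4-p12 (g4), Track A «(D-RAM) FOUR-FRAME», unit U2H, the census leaf
(ρ2b′-X) `stub_U2H_fixedPointCensus_typeTwo_unit0` — RHO2BX-ORDER v1 (LH4-p14 (g3)) organ O-W, part T3-T «the elliptic plane as a field line», file 1: THE DICTIONARY.  2026-09-04.
-/
import Literature.NumberTheory.Automorphic.UnitaryLatticeTreeTubeAxisVertex      -- ★ `isSelfDualLattice_latt_of_dualLatt_eq`; brings ★ Apartment, ★ Dual `mem_latt_iff_of_isUnit`, ★ Defs `latt` `dualLatt` `mapGL`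
import Literature.NumberTheory.LocalFields.QuadraticOrderNormLine                  -- ★ p857156 → ★ T4 p857067 ∕ p857040 ∕ p857021: orders `𝒪^ρ + c𝒪`, Mars 2-free, multiplier criteria
import HarnessLib

/-!
# The elliptic plane as a field line, I: the lattice DICTIONARY between `𝒪_E`-lattices of a plane `E²` and order lattices `z·(𝒪_E + c𝒪_M)` of its line model
# `(M, ×λ)` — images of full lattices are order lattices and conversely, `γ`-stability is `λ`-stability, the dual lattice is the hermitian dual
(Flicker 1998 p. 84 REMARK (Mars); Serre, *Local Fields* III §6; Jacobowitz 1962 §4; Bruhat–Tits 1972 §10)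

Topic `NumberTheory/Automorphic`; namespace `Literature.NumberTheory.Automorphic.EllipticPlaneAsFieldLine`.  THEOREMS ONLY (no definition, no instance, no notation, no named
fact, no `sorry`); kernel lane `--supports stmt-HodgeConjecture-24833` (count-neutral).  Cell `pub/hodgecm-mathlib` (D-0151), crux H413, Track A «(D-RAM) FOUR-FRAME», unit U2H:
RHO2BX-ORDER v1 (payer LH4-p14 (g3)) organ **O-W** («g-stable W-lattices = x·𝒪_j, dual y⁻¹Λ, self-dual ⟺ y unit — transported to `Submodule (Fin 2 → E_w)` through T3»),
part T3-T (transport), statement-first HEAD `F0/P3c/LH4/LH4-p12/g4/t3/EllipticPlaneAsFieldLine.HEAD.v1` e3028a10 sentences (D1)–(D4).  The W-side count that ★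
`UnitaryLatticeTree.ncard_selfDual_fixed_axis_eq` leaves — `#{B ⊂ E² self-dual for H₂, γ₂·B = B}` — is evaluated on the LINE MODEL of the plane: when `γ₂` is regular elliptic,
`E² ≅ M = E(λ)` with `γ₂ ↦ ×λ` and `⟨x, y⟩_{H₂} = Tr_{M∕E}(h·Θ(x)·y)` (PAYER-PLAN-rho2bX D1–D2), and under this isomorphism (i) full `𝒪_E`-lattices `g·𝒪²` correspond to the
ORDER LATTICES `z·(𝒪^ρ + c𝒪)` of ★ Mars 2-free (`QuadraticOrderLattices.exists_eq_mul_order`), (ii) `γ₂B = B ⟺ λ·Λ ⊆ Λ`, (iii) `B^♯ ↔` the hermitian dual of ★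
`QuadraticOrderHermitianDual`.  THIS FILE proves (i)–(iii) for an ABSTRACT line model given by explicit binders; the count transport (C) is the sequel
`EllipticPlaneAsFieldLine`, and the EXISTENCE of the model at a CM place (organ T3-E) is separate.

FRAME (explicit binders; no structure ∕ instance).  W-side: `E` with `Valued E ℤᵐ⁰`, `σ : E →+* E`, Gram matrix `H₂ : Matrix (Fin 2) (Fin 2) E`, `γ₂ g : GL (Fin 2) E`, lattices
`latt g = g·𝒪²` (★ `UnitaryLatticeTree.latt`), `dualLatt σ H₂`, `mapGL`.  M-side = ★ T4: `M` with `Valued M ℤᵐ⁰`, `jE : E →+* M` with `hjfix : ρ z = z ↔ ∃ c, jE c = z`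
and `hjv : |jE c| ≤ 1 ↔ |c| ≤ 1`, `ρ Θ : M →+* M`, `α` with `ρα ≠ α`, `|α| ≤ 1`, `hint`; the order of conductor `c` is the spelled-out predicate `|y| ≤ 1 ∧ |y − ρy| ≤ |c(α − ρα)|`.
LINE MODEL: `φ : (Fin 2 → E) →+ M` additive with `hφs : φ (c • x) = jE c · φ x`, injective (`hφi`) and where needed surjective (`hφo`); `hφγ : φ (γ₂ x) = lam · φ x`;
`hform : jE ⟨x, y⟩_{H₂} = h·Θ(φ x)·φ y + ρ(h·Θ(φ x)·φ y)`.  Images of lattices are `B.toAddSubgroup.map φ`.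

* §0 two-dimensional bookkeeping: `g·u = u₀·(g e₀) + u₁·(g e₁)`; membership in `latt g` by the two integral coordinates; columns of `g ∈ GL₂` are nonzero and not proportional;
  the ORDER `𝒪^ρ + c𝒪 = {p + q·(cα) : p, q fixed integers}` (coordinate form of ★ `mem_order_iff_exists`).
* §1 (D4) **`mem_dualLatt_iff_forall_v_herm_le_one`**: `x ∈ B^♯ ⟺ ∀ a ∈ φ(B), |h·Θ(a)·φx + ρ(h·Θ(a)·φx)| ≤ 1`.
* §2 (D1) **`exists_eq_mul_order_map_latt`**: `φ(g·𝒪²) = z·(𝒪^ρ + c𝒪)` (★ Mars 2-free on the image: nonzero, bounded by the two columns, stable under `jE(𝒪_E)`, not inside a line).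
* §3 (D3) **`mapGL_eq_iff_forall_mul_mem`**: `γ₂·(g𝒪²) = g𝒪² ⟺ lam·φ(g𝒪²) ⊆ φ(g𝒪²)` (`|lam| = 1`: `lam⁻¹ = ρ(lam)·(lam·ρlam)⁻¹` lies in every order containing `lam`, ★ multiplier
  criterion `forall_mul_mem_iff_of_eq_mul_order`).
* §4 (D2) **`exists_latt_map_eq_of_order`**: every `z·(𝒪^ρ + c𝒪)` is `φ(g·𝒪²)` for the `g` with columns `φ⁻¹z`, `φ⁻¹(z·cα)` (invertible: `1, cα` are `E`-independent).
HONEST LABEL: HC_CM is proved only modulo the 7 printed citations (2 remaining named inputs: hLiu418 = stmt-HodgeConjecture-24832, h413 = stmt-HodgeConjecture-24833) until rung 0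
closes; unconditional lattice algebra, count-neutral.

## References
* [Flicker1998UnitaryFL] Y. Z. Flicker, *Elementary proof of the fundamental lemma for a unitary group*, Canad. J. Math. 50 (1998), p. 84 REMARK (Mars: lattices of `E` are `z·R_E(j)`).
* [Serre1979] J.-P. Serre, *Local Fields*, GTM 67 (1979): Ch. III §6 Prop. 11–12 (power bases, duals), Ch. III §3.
* [Jacobowitz1962] R. Jacobowitz, *Hermitian forms over local fields*, Amer. J. Math. 84 (1962): §4 (hermitian lattices and their duals).
* [BruhatTits1972] F. Bruhat, J. Tits, *Groupes réductifs sur un corps local I*, Publ. Math. IHÉS 41 (1972), §10 (lattice models of rank-one groups).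
-/

set_option autoImplicit false

noncomputable section

open scoped Valued WithZero Matrix MatrixGroups
open WithZero
open Literature.NumberTheory.Automorphic Literature.NumberTheory.Automorphic.HermitianLattice Literature.NumberTheory.Automorphic.UnitaryLatticeTree
open Literature.NumberTheory.LocalFields.QuadraticOrder

namespace Literature.NumberTheory.Automorphic.EllipticPlaneAsFieldLine

variable {E M : Type*} [Field E] [Valued E ℤᵐ⁰] [Field M] [Valued M ℤᵐ⁰]

/-! ## §0 Two-dimensional bookkeeping -/

omit [Valued E ℤᵐ⁰] in
/-- `g·u = u₀·(g e₀) + u₁·(g e₁)` for a `2 × 2` matrix. [cite: BruhatTits1972, §10] -/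
theorem mulVec_eq_smul_col_add_smul_col (g : Matrix (Fin 2) (Fin 2) E) (u : Fin 2 → E) :
    g.mulVec u = u 0 • g.mulVec (Pi.single 0 1) + u 1 • g.mulVec (Pi.single 1 1) := by
  ext i
  simp [Matrix.mulVec, dotProduct, Fin.sum_univ_two]
  ring

/-- **Membership in `latt g` (`g ∈ GL₂`) by coordinates**: `x ∈ g·𝒪² ⟺ x = u₀·(g e₀) + u₁·(g e₁)` with `|u₀|, |u₁| ≤ 1`. [cite: BruhatTits1972, §10] -/
theorem mem_latt_iff_exists_two (g : GL (Fin 2) E) (x : Fin 2 → E) :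
    x ∈ latt (g : Matrix (Fin 2) (Fin 2) E) ↔ ∃ u₀ u₁ : E, Valued.v u₀ ≤ 1 ∧ Valued.v u₁ ≤ 1 ∧
      x = u₀ • (g : Matrix (Fin 2) (Fin 2) E).mulVec (Pi.single 0 1) + u₁ • (g : Matrix (Fin 2) (Fin 2) E).mulVec (Pi.single 1 1) := by
  have hg : IsUnit (g : Matrix (Fin 2) (Fin 2) E).det := Matrix.isUnits_det_units g
  constructor
  · intro hx
    have hu := (mem_latt_iff_of_isUnit hg x).1 hx
    refine ⟨((g : Matrix (Fin 2) (Fin 2) E)⁻¹.mulVec x) 0, ((g : Matrix (Fin 2) (Fin 2) E)⁻¹.mulVec x) 1, hu 0, hu 1, ?_⟩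
    rw [← mulVec_eq_smul_col_add_smul_col, Matrix.mulVec_mulVec, Matrix.mul_nonsing_inv _ hg, Matrix.one_mulVec]
  · rintro ⟨u₀, u₁, hu₀, hu₁, rfl⟩
    have hu : (![u₀, u₁] : Fin 2 → E) ∈ stdLattice E 2 := by
      intro i; fin_cases i
      · exact hu₀
      · exact hu₁
    have h := mulVec_mem_latt (g : Matrix (Fin 2) (Fin 2) E) hu
    rwa [mulVec_eq_smul_col_add_smul_col] at h

omit [Valued E ℤᵐ⁰] in
/-- The columns of `g ∈ GL₂` are NOT proportional: `g e₁ ≠ t·(g e₀)`. [cite: BruhatTits1972, §10] -/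
theorem col_one_ne_smul_col_zero (g : GL (Fin 2) E) (t : E) :
    (g : Matrix (Fin 2) (Fin 2) E).mulVec (Pi.single 1 1) ≠ t • (g : Matrix (Fin 2) (Fin 2) E).mulVec (Pi.single 0 1) := by
  intro h
  have hdet : (g : Matrix (Fin 2) (Fin 2) E).det ≠ 0 := (Matrix.isUnits_det_units g).ne_zero
  apply hdet
  have h0 := congrFun h 0
  have h1 := congrFun h 1
  simp [Matrix.mulVec, dotProduct, Pi.single_apply] at h0 h1
  rw [Matrix.det_fin_two, h0, h1]; ring

omit [Valued E ℤᵐ⁰] in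
/-- The columns of `g ∈ GL₂` are nonzero. [cite: BruhatTits1972, §10] -/
theorem col_ne_zero (g : GL (Fin 2) E) (j : Fin 2) : (g : Matrix (Fin 2) (Fin 2) E).mulVec (Pi.single j 1) ≠ 0 := by
  intro h
  have hdet : (g : Matrix (Fin 2) (Fin 2) E).det ≠ 0 := (Matrix.isUnits_det_units g).ne_zero
  apply hdet
  have h0 := congrFun h 0
  have h1 := congrFun h 1
  fin_cases j <;> simp [Matrix.mulVec, dotProduct, Pi.single_apply] at h0 h1 <;> rw [Matrix.det_fin_two, h0, h1] <;> ring

omit [Valued E ℤᵐ⁰] in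
/-- If `x ≠ 0` and `y` is not a multiple of `x`, the `2 × 2` matrix with columns `x, y` has nonzero determinant. [cite: BruhatTits1972, §10] -/
theorem det_cols_ne_zero {x y : Fin 2 → E} (hx : x ≠ 0) (hxy : ∀ t : E, y ≠ t • x) :
    (!![x 0, y 0; x 1, y 1] : Matrix (Fin 2) (Fin 2) E).det ≠ 0 := by
  intro hdet
  rw [Matrix.det_fin_two_of] at hdet
  -- `x 0 * y 1 = y 0 * x 1`
  rcases eq_or_ne (x 0) 0 with h0 | h0
  · have h1 : x 1 ≠ 0 := by
      intro h1; apply hx; ext i; fin_cases i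
      · exact h0
      · exact h1
    have hy0 : y 0 = 0 := by
      rw [h0, zero_mul, zero_sub, neg_eq_zero] at hdet
      rcases mul_eq_zero.1 hdet with hy | hx1
      · exact hy
      · exact absurd hx1 h1
    apply hxy (y 1 / x 1)
    ext i; fin_cases i
    · show y 0 = (y 1 / x 1) * x 0
      rw [hy0, h0, mul_zero]
    · show y 1 = (y 1 / x 1) * x 1
      rw [div_mul_cancel₀ _ h1]
  · apply hxy (y 0 / x 0)
    ext i; fin_cases i
    · show y 0 = (y 0 / x 0) * x 0
      rw [div_mul_cancel₀ _ h0]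
    · show y 1 = (y 0 / x 0) * x 1
      rw [div_mul_eq_mul_div, eq_div_iff h0]
      linear_combination hdet

omit [Valued M ℤᵐ⁰] in
/-- The scalar action of `𝒪_E` on `E²` is the restriction of that of `E`: `φ (r • x) = jE r · φ x` for `r ∈ 𝒪_E`. [cite: BruhatTits1972, §10] -/
theorem map_integer_smul (jE : E →+* M) (φ : (Fin 2 → E) →+ M) (hφs : ∀ (c : E) (x : Fin 2 → E), φ (c • x) = jE c * φ x)
    (r : 𝒪[E]) (x : Fin 2 → E) : φ (r • x) = jE r * φ x := by
  rw [← hφs]; rfl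

/-- **COORDINATE FORM OF THE ORDER**: `y` lies in the order of conductor `c` iff `y = p + q·(cα)` with `p, q` FIXED INTEGERS (★ `mem_order_iff_exists` + the integral coordinates
of ★ part I). [cite: Serre1979, Ch. III §6 Prop. 12] [cite: Flicker1998UnitaryFL, p. 84 REMARK] -/
theorem mem_order_iff_exists_fixed_coords {ρ : M →+* M} {α : M} (hρρ : ∀ x, ρ (ρ x) = x) (hα : ρ α ≠ α) (hα1 : Valued.v α ≤ 1)
    (hint : ∀ z : M, Valued.v z ≤ 1 → Valued.v ((z - ρ z) / (α - ρ α)) ≤ 1) {c : M} (hc : ρ c = c) (hc0 : c ≠ 0) (hc1 : Valued.v c ≤ 1) (y : M) :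
    (Valued.v y ≤ 1 ∧ Valued.v (y - ρ y) ≤ Valued.v (c * (α - ρ α))) ↔
      ∃ p q : M, ρ p = p ∧ Valued.v p ≤ 1 ∧ ρ q = q ∧ Valued.v q ≤ 1 ∧ y = p + q * (c * α) := by
  rw [mem_order_iff_exists hρρ hα hα1 hint hc hc0 hc1]
  constructor
  · rintro ⟨a, w, ha, ha1, hw1, rfl⟩
    -- `w = a(w) + b(w)·α` with fixed integral coordinates
    refine ⟨a + c * (w - (w - ρ w) / (α - ρ α) * α), (w - ρ w) / (α - ρ α), ?_, ?_, map_bCoord hρρ α w, hint w hw1, ?_⟩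
    · rw [map_add, map_mul, ha, hc, map_aCoord hρρ hα w]
    · refine (Valuation.map_add _ _ _).trans (max_le ha1 ?_)
      rw [map_mul]; exact mul_le_one' hc1 (v_aCoord_le_one hα1 hint hw1)
    · ring
  · rintro ⟨p, q, hp, hp1, hq, hq1, rfl⟩
    refine ⟨p, q * α, hp, hp1, ?_, by ring⟩
    rw [map_mul]; exact mul_le_one' hq1 hα1

/-! ## §1 (D4) The dual lattice is the hermitian dual -/

/-- **(D4) THE DUAL LATTICE IS THE HERMITIAN DUAL OF THE IMAGE**: `x ∈ B^♯ ⟺ ∀ a ∈ φ(B), |h·Θ(a)·φx + ρ(h·Θ(a)·φx)| ≤ 1` (the form dictionary `hform` and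
`|jE t| ≤ 1 ↔ |t| ≤ 1`). [cite: Jacobowitz1962, §4] -/
theorem mem_dualLatt_iff_forall_v_herm_le_one (σ : E →+* E) (H₂ : Matrix (Fin 2) (Fin 2) E) (jE : E →+* M) (ρ Θ : M →+* M) (h : M)
    (hjv : ∀ c, Valued.v (jE c) ≤ 1 ↔ Valued.v c ≤ 1)
    (φ : (Fin 2 → E) →+ M) (hform : ∀ x y, jE (pairing σ H₂ x y) = h * Θ (φ x) * φ y + ρ (h * Θ (φ x) * φ y))
    (B : Submodule 𝒪[E] (Fin 2 → E)) (x : Fin 2 → E) :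
    x ∈ dualLatt σ H₂ B ↔ ∀ a ∈ B.toAddSubgroup.map φ, Valued.v (h * Θ a * φ x + ρ (h * Θ a * φ x)) ≤ 1 := by
  rw [mem_dualLatt]
  constructor
  · intro H a ha
    obtain ⟨y, hy, rfl⟩ := AddSubgroup.mem_map.1 ha
    rw [← hform, hjv]
    exact H y hy
  · intro H y hy
    rw [← hjv, hform]
    exact H (φ y) (AddSubgroup.mem_map.2 ⟨y, hy, rfl⟩)

/-! ## §2 (D1) The image of a full lattice is an order lattice -/

omit [Valued M ℤᵐ⁰] in
/-- Membership in the image lattice: `m ∈ φ(g·𝒪²) ⟺ m = jE u₀·φ(g e₀) + jE u₁·φ(g e₁)` with `|u₀|, |u₁| ≤ 1`. [cite: BruhatTits1972, §10] -/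
theorem mem_map_latt_iff (jE : E →+* M) (φ : (Fin 2 → E) →+ M) (hφs : ∀ (c : E) (x : Fin 2 → E), φ (c • x) = jE c * φ x)
    (g : GL (Fin 2) E) (m : M) :
    m ∈ (latt (g : Matrix (Fin 2) (Fin 2) E)).toAddSubgroup.map φ ↔ ∃ u₀ u₁ : E, Valued.v u₀ ≤ 1 ∧ Valued.v u₁ ≤ 1 ∧
      m = jE u₀ * φ ((g : Matrix (Fin 2) (Fin 2) E).mulVec (Pi.single 0 1)) + jE u₁ * φ ((g : Matrix (Fin 2) (Fin 2) E).mulVec (Pi.single 1 1)) := by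
  rw [AddSubgroup.mem_map]
  constructor
  · rintro ⟨x, hx, rfl⟩
    obtain ⟨u₀, u₁, hu₀, hu₁, rfl⟩ := (mem_latt_iff_exists_two g x).1 hx
    exact ⟨u₀, u₁, hu₀, hu₁, by rw [map_add, hφs, hφs]⟩
  · rintro ⟨u₀, u₁, hu₀, hu₁, rfl⟩
    exact ⟨u₀ • (g : Matrix (Fin 2) (Fin 2) E).mulVec (Pi.single 0 1) + u₁ • (g : Matrix (Fin 2) (Fin 2) E).mulVec (Pi.single 1 1),
      (mem_latt_iff_exists_two g _).2 ⟨u₀, u₁, hu₀, hu₁, rfl⟩, by rw [map_add, hφs, hφs]⟩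

/-- **(D1) THE IMAGE OF A FULL LATTICE IS AN ORDER LATTICE** `z·(𝒪^ρ + c𝒪)` (★ Mars 2-free `exists_eq_mul_order`: the image is nonzero, bounded, stable under the fixed integers
`jE(𝒪_E)`, and not inside a line `z·Fix ρ` because the two columns of `g` are `E`-independent and `φ` is injective). [cite: Flicker1998UnitaryFL, p. 84 REMARK] -/
theorem exists_eq_mul_order_map_latt (jE : E →+* M) {ρ : M →+* M} {α : M}
    (hρρ : ∀ x, ρ (ρ x) = x) (hα : ρ α ≠ α) (hα1 : Valued.v α ≤ 1) (hint : ∀ z : M, Valued.v z ≤ 1 → Valued.v ((z - ρ z) / (α - ρ α)) ≤ 1)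
    (hjv : ∀ c, Valued.v (jE c) ≤ 1 ↔ Valued.v c ≤ 1) (hjfix : ∀ z, ρ z = z ↔ ∃ c, jE c = z)
    (φ : (Fin 2 → E) →+ M) (hφs : ∀ (c : E) (x : Fin 2 → E), φ (c • x) = jE c * φ x) (hφi : Function.Injective φ) (g : GL (Fin 2) E) :
    ∃ z c : M, z ≠ 0 ∧ ρ c = c ∧ c ≠ 0 ∧ Valued.v c ≤ 1 ∧
      ∀ x, x ∈ (latt (g : Matrix (Fin 2) (Fin 2) E)).toAddSubgroup.map φ ↔
        ∃ y, (Valued.v y ≤ 1 ∧ Valued.v (y - ρ y) ≤ Valued.v (c * (α - ρ α))) ∧ x = z * y := by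
  set Λ := (latt (g : Matrix (Fin 2) (Fin 2) E)).toAddSubgroup.map φ with hΛ
  set x₀ : Fin 2 → E := (g : Matrix (Fin 2) (Fin 2) E).mulVec (Pi.single 0 1) with hx₀
  set x₁ : Fin 2 → E := (g : Matrix (Fin 2) (Fin 2) E).mulVec (Pi.single 1 1) with hx₁
  have hmem : ∀ m, m ∈ Λ ↔ ∃ u₀ u₁ : E, Valued.v u₀ ≤ 1 ∧ Valued.v u₁ ≤ 1 ∧ m = jE u₀ * φ x₀ + jE u₁ * φ x₁ := mem_map_latt_iff jE φ hφs g
  -- stability under fixed integers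
  have hmul : ∀ r x, ρ r = r → Valued.v r ≤ 1 → x ∈ Λ → r * x ∈ Λ := by
    intro r x hr hr1 hx
    obtain ⟨e, rfl⟩ := (hjfix r).1 hr
    obtain ⟨u₀, u₁, hu₀, hu₁, rfl⟩ := (hmem x).1 hx
    refine (hmem _).2 ⟨e * u₀, e * u₁, ?_, ?_, by rw [map_mul, map_mul]; ring⟩
    · rw [map_mul]; exact mul_le_one' ((hjv e).1 hr1) hu₀
    · rw [map_mul]; exact mul_le_one' ((hjv e).1 hr1) hu₁
  -- nonzero
  have hne : ∃ x ∈ Λ, x ≠ 0 := by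
    refine ⟨φ x₀, (hmem _).2 ⟨1, 0, by rw [map_one], by rw [map_zero]; exact zero_le_one, by rw [map_one, map_zero, one_mul, zero_mul, add_zero]⟩, ?_⟩
    intro h0
    exact col_ne_zero g 0 (hφi (by rw [h0, map_zero]))
  -- bounded by the two columns
  have hbd : ∃ N : ℤ, ∀ x ∈ Λ, Valued.v x ≤ exp N := by
    obtain ⟨N, hN⟩ : ∃ N : ℤ, Valued.v (φ x₀) ≤ exp N ∧ Valued.v (φ x₁) ≤ exp N := by
      refine ⟨max (log (max (Valued.v (φ x₀)) 1)) (log (max (Valued.v (φ x₁)) 1)), ?_, ?_⟩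
      · have h1 : Valued.v (φ x₀) ≤ max (Valued.v (φ x₀)) 1 := le_max_left _ _
        have hne0 : max (Valued.v (φ x₀)) 1 ≠ 0 := ne_of_gt (lt_of_lt_of_le zero_lt_one (le_max_right _ _))
        refine h1.trans ?_
        rw [← exp_log hne0, exp_le_exp]; exact le_max_left _ _
      · have h1 : Valued.v (φ x₁) ≤ max (Valued.v (φ x₁)) 1 := le_max_left _ _
        have hne0 : max (Valued.v (φ x₁)) 1 ≠ 0 := ne_of_gt (lt_of_lt_of_le zero_lt_one (le_max_right _ _))
        refine h1.trans ?_
        rw [← exp_log hne0, exp_le_exp]; exact le_max_right _ _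
    refine ⟨N, fun x hx => ?_⟩
    obtain ⟨u₀, u₁, hu₀, hu₁, rfl⟩ := (hmem x).1 hx
    refine (Valuation.map_add _ _ _).trans (max_le ?_ ?_)
    · rw [map_mul]; exact (mul_le_of_le_one_left' ((hjv u₀).2 hu₀)).trans hN.1
    · rw [map_mul]; exact (mul_le_of_le_one_left' ((hjv u₁).2 hu₁)).trans hN.2
  -- not inside a line `z·Fix ρ`
  have hrk : ¬ ∃ z : M, ∀ x ∈ Λ, ∃ r, ρ r = r ∧ x = z * r := by
    rintro ⟨z, hz⟩
    have h0 : φ x₀ ∈ Λ := (hmem _).2 ⟨1, 0, by rw [map_one], by rw [map_zero]; exact zero_le_one, by rw [map_one, map_zero, one_mul, zero_mul, add_zero]⟩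
    have h1 : φ x₁ ∈ Λ := (hmem _).2 ⟨0, 1, by rw [map_zero]; exact zero_le_one, by rw [map_one], by rw [map_one, map_zero, one_mul, zero_mul, zero_add]⟩
    obtain ⟨r₀, hr₀, h0z⟩ := hz _ h0
    obtain ⟨r₁, hr₁, h1z⟩ := hz _ h1
    obtain ⟨e₀, rfl⟩ := (hjfix r₀).1 hr₀
    obtain ⟨e₁, rfl⟩ := (hjfix r₁).1 hr₁
    have he₀ : e₀ ≠ 0 := by
      rintro rfl
      rw [map_zero, mul_zero] at h0z
      exact col_ne_zero g 0 (hφi (by rw [← hx₀, h0z, map_zero]))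
    -- `φ x₁ = jE(e₁∕e₀) · φ x₀ = φ ((e₁∕e₀) • x₀)`
    have hje₀ : jE e₀ ≠ 0 := (map_ne_zero jE).2 he₀
    have hprop : φ x₁ = φ ((e₁ / e₀) • x₀) := by
      rw [hφs, map_div₀, h1z, h0z]
      field_simp
    exact col_one_ne_smul_col_zero g (e₁ / e₀) (hφi hprop)
  obtain ⟨z, c, -, hz0, hcfix, hc0, hc1, hiff⟩ := exists_eq_mul_order hρρ hα hα1 hint Λ hmul hne hbd hrk
  exact ⟨z, c, hz0, hcfix, hc0, hc1, hiff⟩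

/-! ## §3 (D3) `γ₂`-stability is `lam`-stability -/

/-- `lam⁻¹` lies in every order containing `lam` when `|lam| = 1`: `lam⁻¹ = ρ(lam)·(lam·ρ lam)⁻¹` with `lam·ρlam` a fixed UNIT. [cite: Serre1979, Ch. III §6 Prop. 12] -/
theorem inv_mem_order_of_mem_order {ρ : M →+* M} {α : M} (hρρ : ∀ x, ρ (ρ x) = x) (hvρ : ∀ x, Valued.v (ρ x) = Valued.v x)
    {c lam : M} (hlam : Valued.v lam = 1) (hmem : Valued.v lam ≤ 1 ∧ Valued.v (lam - ρ lam) ≤ Valued.v (c * (α - ρ α))) :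
    Valued.v lam⁻¹ ≤ 1 ∧ Valued.v (lam⁻¹ - ρ lam⁻¹) ≤ Valued.v (c * (α - ρ α)) := by
  have hlam0 : lam ≠ 0 := fun h0 => by rw [h0, map_zero] at hlam; exact zero_ne_one hlam
  have hρlam0 : ρ lam ≠ 0 := (map_ne_zero ρ).2 hlam0
  have hrew : lam⁻¹ = ρ lam * (lam * ρ lam)⁻¹ := by field_simp
  rw [hrew]
  refine mul_mem_order hvρ (map_mem_order hρρ hvρ hmem) (mem_order_of_fixed c ?_ ?_)
  · rw [map_inv₀, map_mul_map_self hρρ]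
  · rw [map_inv₀, map_mul, hvρ, hlam, mul_one, inv_one]

/-- **(D3) `γ₂`-STABILITY ⟺ `lam`-STABILITY**: `γ₂·(g𝒪²) = g𝒪² ⟺ lam·φ(g𝒪²) ⊆ φ(g𝒪²)`.  (`⇐`: `⊆` pulls back along the injective `φ`; the reverse inclusion because the
image is an order lattice `z·𝒪_c` (D1), `lam·Λ ⊆ Λ ⟺ lam ∈ 𝒪_c` (★ `forall_mul_mem_iff_of_eq_mul_order`) and then `lam⁻¹ ∈ 𝒪_c` too.) [cite: BruhatTits1972, §10] [cite: Flicker1998UnitaryFL, p. 84 REMARK] -/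
theorem mapGL_eq_iff_forall_mul_mem (jE : E →+* M) {ρ : M →+* M} {α : M}
    (hρρ : ∀ x, ρ (ρ x) = x) (hvρ : ∀ x, Valued.v (ρ x) = Valued.v x) (hα : ρ α ≠ α) (hα1 : Valued.v α ≤ 1)
    (hint : ∀ z : M, Valued.v z ≤ 1 → Valued.v ((z - ρ z) / (α - ρ α)) ≤ 1)
    (hjv : ∀ c, Valued.v (jE c) ≤ 1 ↔ Valued.v c ≤ 1) (hjfix : ∀ z, ρ z = z ↔ ∃ c, jE c = z)
    (φ : (Fin 2 → E) →+ M) (hφs : ∀ (c : E) (x : Fin 2 → E), φ (c • x) = jE c * φ x) (hφi : Function.Injective φ)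
    {γ₂ : GL (Fin 2) E} {lam : M} (hφγ : ∀ x, φ ((γ₂ : Matrix (Fin 2) (Fin 2) E).mulVec x) = lam * φ x) (hlam : Valued.v lam = 1) (g : GL (Fin 2) E) :
    mapGL γ₂ (latt (g : Matrix (Fin 2) (Fin 2) E)) = latt (g : Matrix (Fin 2) (Fin 2) E) ↔
      ∀ x ∈ (latt (g : Matrix (Fin 2) (Fin 2) E)).toAddSubgroup.map φ, lam * x ∈ (latt (g : Matrix (Fin 2) (Fin 2) E)).toAddSubgroup.map φ := by
  set B := latt (g : Matrix (Fin 2) (Fin 2) E) with hB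
  have hlam0 : lam ≠ 0 := fun h0 => by rw [h0, map_zero] at hlam; exact zero_ne_one hlam
  have hφγ' : ∀ x, φ (((γ₂⁻¹ : GL (Fin 2) E) : Matrix (Fin 2) (Fin 2) E).mulVec x) = lam⁻¹ * φ x := by
    intro x
    have h := hφγ (((γ₂⁻¹ : GL (Fin 2) E) : Matrix (Fin 2) (Fin 2) E).mulVec x)
    rw [Matrix.mulVec_mulVec, ← Units.val_mul, mul_inv_cancel, Units.val_one, Matrix.one_mulVec] at h
    rw [eq_inv_mul_iff_mul_eq₀ hlam0, ← h]
  -- membership in `mapGL γ M`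
  have hmapGL : ∀ (γ : GL (Fin 2) E) (N : Submodule 𝒪[E] (Fin 2 → E)) (y : Fin 2 → E),
      y ∈ mapGL γ N ↔ ((γ⁻¹ : GL (Fin 2) E) : Matrix (Fin 2) (Fin 2) E).mulVec y ∈ N := by
    intro γ N y
    rw [mapGL, Submodule.mem_map]
    constructor
    · rintro ⟨x, hx, rfl⟩
      rw [LinearMap.restrictScalars_apply, Matrix.toLin'_apply, Matrix.mulVec_mulVec, ← Units.val_mul, inv_mul_cancel, Units.val_one, Matrix.one_mulVec]
      exact hx
    · intro hy
      refine ⟨_, hy, ?_⟩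
      rw [LinearMap.restrictScalars_apply, Matrix.toLin'_apply, Matrix.mulVec_mulVec, ← Units.val_mul, mul_inv_cancel, Units.val_one, Matrix.one_mulVec]
  constructor
  · intro hfix x hx
    obtain ⟨b, hb, rfl⟩ := AddSubgroup.mem_map.1 hx
    rw [← hφγ]
    refine AddSubgroup.mem_map.2 ⟨_, ?_, rfl⟩
    have : (γ₂ : Matrix (Fin 2) (Fin 2) E).mulVec b ∈ mapGL γ₂ B := by
      rw [hmapGL, Matrix.mulVec_mulVec, ← Units.val_mul, inv_mul_cancel, Units.val_one, Matrix.one_mulVec]; exact hb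
    rw [hfix] at this
    exact this
  · intro hstab
    -- the image is an order lattice; `lam` and `lam⁻¹` are multipliers
    obtain ⟨z, c, hz0, hcfix, hc0, hc1, hiff⟩ := exists_eq_mul_order_map_latt jE hρρ hα hα1 hint hjv hjfix φ hφs hφi g
    have hlamO := (forall_mul_mem_iff_of_eq_mul_order hvρ hz0 hiff lam).1 hstab
    have hinvO := inv_mem_order_of_mem_order hρρ hvρ hlam hlamO
    have hstab' : ∀ x ∈ B.toAddSubgroup.map φ, lam⁻¹ * x ∈ B.toAddSubgroup.map φ :=
      (forall_mul_mem_iff_of_eq_mul_order hvρ hz0 hiff lam⁻¹).2 hinvO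
    -- pull both inclusions back along `φ`
    have hfwd : ∀ b ∈ B, (γ₂ : Matrix (Fin 2) (Fin 2) E).mulVec b ∈ B := by
      intro b hb
      have h := hstab (φ b) (AddSubgroup.mem_map.2 ⟨b, hb, rfl⟩)
      rw [← hφγ] at h
      obtain ⟨b', hb', hbb'⟩ := AddSubgroup.mem_map.1 h
      rw [← hφi hbb']; exact hb'
    have hbwd : ∀ b ∈ B, ((γ₂⁻¹ : GL (Fin 2) E) : Matrix (Fin 2) (Fin 2) E).mulVec b ∈ B := by
      intro b hb
      have h := hstab' (φ b) (AddSubgroup.mem_map.2 ⟨b, hb, rfl⟩)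
      rw [← hφγ'] at h
      obtain ⟨b', hb', hbb'⟩ := AddSubgroup.mem_map.1 h
      rw [← hφi hbb']; exact hb'
    apply le_antisymm
    · intro y hy
      rw [hmapGL] at hy
      have := hfwd _ hy
      rwa [Matrix.mulVec_mulVec, ← Units.val_mul, mul_inv_cancel, Units.val_one, Matrix.one_mulVec] at this
    · intro y hy
      rw [hmapGL]
      exact hbwd y hy

/-! ## §4 (D2) Every order lattice is the image of a full lattice -/

/-- **(D2) EVERY ORDER LATTICE IS THE IMAGE OF A FULL LATTICE**: `z·(𝒪^ρ + c𝒪) = φ(g·𝒪²)` for the `g ∈ GL₂(E)` whose columns are `φ⁻¹ z` and `φ⁻¹(z·cα)` (they are not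
proportional since `1, cα` are independent over the fixed field). [cite: Flicker1998UnitaryFL, p. 84 REMARK] [cite: Serre1979, Ch. III §6 Prop. 12] -/
theorem exists_latt_map_eq_of_order (jE : E →+* M) {ρ : M →+* M} {α : M}
    (hρρ : ∀ x, ρ (ρ x) = x) (hα : ρ α ≠ α) (hα1 : Valued.v α ≤ 1) (hint : ∀ z : M, Valued.v z ≤ 1 → Valued.v ((z - ρ z) / (α - ρ α)) ≤ 1)
    (hjv : ∀ c, Valued.v (jE c) ≤ 1 ↔ Valued.v c ≤ 1) (hjfix : ∀ z, ρ z = z ↔ ∃ c, jE c = z)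
    (φ : (Fin 2 → E) →+ M) (hφs : ∀ (c : E) (x : Fin 2 → E), φ (c • x) = jE c * φ x) (hφo : Function.Surjective φ)
    {Λ : AddSubgroup M} {z c : M} (hz : z ≠ 0) (hc : ρ c = c) (hc0 : c ≠ 0) (hc1 : Valued.v c ≤ 1)
    (hΛ : ∀ x, x ∈ Λ ↔ ∃ y, (Valued.v y ≤ 1 ∧ Valued.v (y - ρ y) ≤ Valued.v (c * (α - ρ α))) ∧ x = z * y) :
    ∃ g : GL (Fin 2) E, (latt (g : Matrix (Fin 2) (Fin 2) E)).toAddSubgroup.map φ = Λ := by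
  obtain ⟨b₀, hb₀⟩ := hφo z
  obtain ⟨b₁, hb₁⟩ := hφo (z * (c * α))
  -- the two columns are nonzero and not proportional
  have hb₀0 : b₀ ≠ 0 := by rintro rfl; exact hz (by rw [← hb₀, map_zero])
  have hprop : ∀ t : E, b₁ ≠ t • b₀ := by
    intro t ht
    have h1 : z * (c * α) = jE t * z := by rw [← hb₁, ht, hφs, hb₀]
    have h2 : c * α = jE t := mul_left_cancel₀ hz (by rw [h1, mul_comm])
    -- `cα` fixed would force `α` fixed
    have h3 : ρ (c * α) = c * α := by rw [h2]; exact (hjfix _).2 ⟨t, rfl⟩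
    rw [map_mul, hc] at h3
    exact hα (mul_left_cancel₀ hc0 h3)
  set A : Matrix (Fin 2) (Fin 2) E := !![b₀ 0, b₁ 0; b₀ 1, b₁ 1] with hA
  have hAdet : A.det ≠ 0 := det_cols_ne_zero hb₀0 hprop
  set g : GL (Fin 2) E := Matrix.GeneralLinearGroup.mkOfDetNeZero A hAdet with hg
  have hgA : (g : Matrix (Fin 2) (Fin 2) E) = A := rfl
  have hcol0 : (g : Matrix (Fin 2) (Fin 2) E).mulVec (Pi.single 0 1) = b₀ := by
    rw [hgA]; ext i; fin_cases i <;> simp [hA, Matrix.mulVec, dotProduct, Fin.sum_univ_two]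
  have hcol1 : (g : Matrix (Fin 2) (Fin 2) E).mulVec (Pi.single 1 1) = b₁ := by
    rw [hgA]; ext i; fin_cases i <;> simp [hA, Matrix.mulVec, dotProduct, Fin.sum_univ_two]
  refine ⟨g, AddSubgroup.ext fun m => ?_⟩
  rw [mem_map_latt_iff jE φ hφs g, hcol0, hcol1, hb₀, hb₁, hΛ m]
  constructor
  · rintro ⟨u₀, u₁, hu₀, hu₁, rfl⟩
    refine ⟨jE u₀ + jE u₁ * (c * α), (mem_order_iff_exists_fixed_coords hρρ hα hα1 hint hc hc0 hc1 _).2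
      ⟨jE u₀, jE u₁, (hjfix _).2 ⟨u₀, rfl⟩, (hjv u₀).2 hu₀, (hjfix _).2 ⟨u₁, rfl⟩, (hjv u₁).2 hu₁, rfl⟩, by ring⟩
  · rintro ⟨y, hy, rfl⟩
    obtain ⟨p, q, hp, hp1, hq, hq1, rfl⟩ := (mem_order_iff_exists_fixed_coords hρρ hα hα1 hint hc hc0 hc1 y).1 hy
    obtain ⟨u₀, rfl⟩ := (hjfix p).1 hp
    obtain ⟨u₁, rfl⟩ := (hjfix q).1 hq
    exact ⟨u₀, u₁, (hjv u₀).1 hp1, (hjv u₁).1 hq1, by ring⟩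

end Literature.NumberTheory.Automorphic.EllipticPlaneAsFieldLine

end
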